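import Summits.SmoothPoincare4.SmoothPoincare4.Theorems.ConvexBisectionAcyclicBisectionExistsBeltMonodromyModel
import Summits.SmoothPoincare4.SmoothPoincare4.Theorems.ConvexBisectionAcyclicBisectionExistsBeltMonodromyBeltChart
import HarnessLib

/-!
# N1 ▸ `node_N1_move` ▸ (d) N1-mono (the deep-belt monodromy model), brick H4-4:
# THE BELT SLOPE IN BELT COORDINATES — value, smoothness and full differential at the belt circle
(wave 7, crux stmt-SmoothPoincare4-10508, line `modp-braid-orbits`, registered stub `stub_M2geo` (N1) ▸
`node_N1_move` ▸ sub-node (d); registered sub-goal `helper_beltSlope_hasFDerivAt`)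

The boundary open book of `X` read on `∂X₀` is `θ_X (y) = arg w (Ψ y)`; in the belt chart
`B (u, m) := ∂(G₀⁻¹) (β♭ (e^{2πiu}, m))` of handle `k` (`…BeltMonodromyBeltChart.lean`) and relative to the
direction `c := d k` of the handle it is the BELT SLOPE

    Sl (u, m) := S_c (W (u, m)),   W (u, m) := w (Ψ (B (u, m))),   S_c z := Im (c̄ z) / Re (c̄ z).

This file proves piece (d4) of H4-REPORT §4 in the telescope of `node_N1_move` (boundary datum `bX` of the
ORIGINAL piece, `G₀ : X₀ ≅ X`, seam and belt clauses through `G₀`):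
* §1 the belt circle is on the ray: `W (u, 0) ∈ ℝ_{>0} · c` (belt clause), so `Sl (u, 0) = 0`;
* §2 the canonical boundary datum of `X` with `Ψ' := Ψ ∘ ∂(G₀⁻¹)` satisfies the page clause, and H4-1's belt
  matrix transfers: ONE injective `M : ℝ² →L ℝ²` with `∂_m Sl (θ, 0) · v = ⟪M θ, v⟫` (`exists_beltMatrix_G₀`);
* §3 `W` is smooth on `ℝ × ball 0 1`, `Re (c̄ W) > 0` on a uniform belt `ℝ × ball 0 ρ`, `Sl` is smooth there,
  and (`beltSlope_package`; registered `helper_beltSlope_hasFDerivAt`) **`Sl` has at every belt-circle point `(u, 0)` the full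
  differential `(δu, δm) ↦ ⟪M (e^{2πiu}), δm⟫`** — a SUBMERSION along the belt circle, with vanishing
  `u`-derivative: the linearised deep-belt model `Θ_X (u, m) ≈ ⟪M u, m⟫`.

Everything is proved; no named facts, no `sorry`.  References: A. A. Kosinski, *Differential Manifolds*
(1993), VI §6 [Kosinski1993]; J. B. Etnyre, T. Fuller, IMRN 2006, Thm. 1 (proof, p. 8) [EtnyreFuller2006].
-/

noncomputable section

set_option linter.dupNamespace false

open scoped Manifold ContDiff Topology ComplexConjugate
open Set Function Metric Complex Filter
open Literature.Topology.FourManifolds Literature.Topology.FourManifolds.HandleAttachingMap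
  Literature.Topology.FourManifolds.LefschetzBase

namespace Summit.SmoothPoincare4.SmoothPoincare4.Theorems.AcyclicBisectionExists.ModpBraidOrbits

variable {g n : ℕ} {h : Fin n → HandleAttachingMap 3 2 (Base g)}
  {X₀ : Type} [TopologicalSpace X₀] [ChartedSpace (EuclideanHalfSpace 4) X₀]
  (bX : BoundaryData (𝓡∂ 4) X₀ (𝓡 3)) (Ψ : bX.carrier ≃ₘ⟮𝓡 3, 𝓡 3⟯ (bBase g).carrier)
  {X : Type} [TopologicalSpace X] [ChartedSpace (EuclideanHalfSpace 4) X] [IsManifold (𝓡∂ 4) ∞ X]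
  (G₀ : X₀ ≃ₘ⟮𝓡∂ 4, 𝓡∂ 4⟯ X) (D : MultiAttachmentData h (𝓡∂ 4) X) (d : Fin n → ℂ) (k : Fin n)

/-! ## §1 The belt circle is on the ray of the handle direction -/

/-- **At the belt circle the belt chart point has `w (Ψ ·)` on the ray `ℝ_{>0} · d k`** (belt clause through
`G₀`, the core of the belt chart being a deep belt-circle point). [cite: Kosinski1993, VI §6] -/
theorem beltChart_zero_ray
    (hbelt : ∀ (y : bX.carrier) (j : Fin n) (b : ↥(beltPiece 3 2)), G₀ (bX.incl y) = D.jB j b →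
      G₀ (bX.incl y) ∉ range D.jA →
      ∃ c : ℝ, 0 < c ∧ w g ((bBase g).incl (Ψ y)).1 = (c : ℂ) * d j)
    (θ : sphere (0 : EuclideanSpace ℝ (Fin 2)) 1) :
    ∃ t : ℝ, 0 < t ∧ w g ((bBase g).incl (Ψ ((BoundaryManifold.boundaryData 3 X).restrictDiffeomorph bX G₀.symm
      ((beltMap D k).boundaryTube.toHomeo (θ, (0 : EuclideanSpace ℝ (Fin 2))))))).1 = (t : ℂ) * d k :=
  hbelt _ k (beltCirclePt θ) (beltChart_zero bX G₀ D k θ) (beltChart_zero_not_mem_range bX G₀ D k θ)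

/-! ## §2 The belt matrix through `G₀` -/

/-- The restriction of the identity to the canonical boundary datum is the identity. [folklore] -/
theorem restrictDiffeomorph_refl_apply (z : (BoundaryManifold.boundaryData 3 X).carrier) :
    (BoundaryManifold.boundaryData 3 X).restrictDiffeomorph (BoundaryManifold.boundaryData 3 X)
      (Diffeomorph.refl (𝓡∂ 4) X ∞) z = z := by
  apply (BoundaryManifold.boundaryData 3 X).injective_incl
  rw [BoundaryData.incl_restrictDiffeomorph]
  rfl

/-- **The seam diffeomorphism of the canonical datum with `Ψ' := Ψ ∘ ∂(G₀⁻¹)` is `Ψ ∘ ∂(G₀⁻¹)` on points.**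
[folklore] -/
theorem incl_seamDiffeo_canonical (z : (BoundaryManifold.boundaryData 3 X).carrier) :
    (BoundaryManifold.boundaryData 3 (Base g)).incl (seamDiffeo (BoundaryManifold.boundaryData 3 X) (bBase g)
      (((BoundaryManifold.boundaryData 3 X).restrictDiffeomorph bX G₀.symm).trans Ψ) z) =
      (bBase g).incl (Ψ ((BoundaryManifold.boundaryData 3 X).restrictDiffeomorph bX G₀.symm z)) := by
  rw [coe_seamDiffeo, restrictDiffeomorph_refl_apply]
  rfl

/-- **The page clause of the canonical datum** `(∂X, Ψ ∘ ∂(G₀⁻¹))` from the seam clause through `G₀`.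
[folklore] -/
theorem pageClause_canonical
    (hseam : ∀ (y : bX.carrier) (a : ↥(coresComplement h)), G₀ (bX.incl y) = D.jA a →
      ∃ c : ℝ, 0 < c ∧ w g ((bBase g).incl (Ψ y)).1 = (c : ℂ) * w g (a : Base g).1)
    (y' : (BoundaryManifold.boundaryData 3 X).carrier) (a : ↥(coresComplement h))
    (hy' : (BoundaryManifold.boundaryData 3 X).incl y' = D.jA a) :
    ∃ c : ℝ, 0 < c ∧ w g ((bBase g).incl ((((BoundaryManifold.boundaryData 3 X).restrictDiffeomorph bX
      G₀.symm).trans Ψ) y')).1 = (c : ℂ) * w g (a : Base g).1 := by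
  have hG : G₀ (bX.incl ((BoundaryManifold.boundaryData 3 X).restrictDiffeomorph bX G₀.symm y')) = D.jA a := by
    rw [G₀_incl_restrict]; exact hy'
  exact hseam _ a hG

/-- **The belt matrix through `G₀`** (H4-1 transferred to the telescope of `node_N1_move`): under the seam and belt
clauses through `G₀`, with the core of handle `k` in the page of the unit direction `d k`, there is ONE injective
`M : ℝ² →L ℝ²` with `∂_m Sl (θ, 0) · v = ⟪M θ, v⟫` for all belt-circle points `θ` and unit `v`, where
`Sl (θ, m) = S_{d k} (w (Ψ (∂(G₀⁻¹) (β♭ (θ, m)))))`. [cite: EtnyreFuller2006, Thm. 1 (proof, p. 8)] -/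
theorem exists_beltMatrix_G₀ (hd : ‖d k‖ = 1) (hcore : ∀ θ, (h k).attachingCircle θ ∈ page g (d k))
    (hseam : ∀ (y : bX.carrier) (a : ↥(coresComplement h)), G₀ (bX.incl y) = D.jA a →
      ∃ c : ℝ, 0 < c ∧ w g ((bBase g).incl (Ψ y)).1 = (c : ℂ) * w g (a : Base g).1)
    (hbelt : ∀ (y : bX.carrier) (j : Fin n) (b : ↥(beltPiece 3 2)), G₀ (bX.incl y) = D.jB j b →
      G₀ (bX.incl y) ∉ range D.jA →
      ∃ c : ℝ, 0 < c ∧ w g ((bBase g).incl (Ψ y)).1 = (c : ℂ) * d j) :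
    ∃ M : EuclideanSpace ℝ (Fin 2) →L[ℝ] EuclideanSpace ℝ (Fin 2), Injective M ∧
      ∀ θ v : sphere (0 : EuclideanSpace ℝ (Fin 2)) 1,
        fderiv ℝ (fun m : EuclideanSpace ℝ (Fin 2) =>
          (conj (d k) * w g ((bBase g).incl (Ψ ((BoundaryManifold.boundaryData 3 X).restrictDiffeomorph bX G₀.symm
            ((beltMap D k).boundaryTube.toHomeo (θ, m))))).1).im /
          (conj (d k) * w g ((bBase g).incl (Ψ ((BoundaryManifold.boundaryData 3 X).restrictDiffeomorph bX G₀.symm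
            ((beltMap D k).boundaryTube.toHomeo (θ, m))))).1).re) 0 (v : EuclideanSpace ℝ (Fin 2)) =
        inner ℝ (M (θ : EuclideanSpace ℝ (Fin 2))) (v : EuclideanSpace ℝ (Fin 2)) := by
  set Ψ' := ((BoundaryManifold.boundaryData 3 X).restrictDiffeomorph bX G₀.symm).trans Ψ with hΨ'
  have hray : ∀ θ : sphere (0 : EuclideanSpace ℝ (Fin 2)) 1, ∃ t : ℝ, 0 < t ∧
      w g (id ((BoundaryManifold.boundaryData 3 (Base g)).incl (seamDiffeo (BoundaryManifold.boundaryData 3 X)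
        (bBase g) Ψ' ((beltMap D k).boundaryTube.toHomeo (θ, (0 : EuclideanSpace ℝ (Fin 2))))))).1 =
        (t : ℂ) * d k := fun θ => by
    rw [id, incl_seamDiffeo_canonical]
    exact beltChart_zero_ray bX Ψ G₀ D d k hbelt θ
  obtain ⟨M, hMi, hM⟩ := helper_beltMatrix_nondegenerate g (Fin n) h X D (BoundaryManifold.boundaryData 3 X) Ψ'
    (pageClause_canonical bX Ψ G₀ D hseam) k (d k) hd hcore id contMDiff_id
    (fun x => ⟨1, one_pos, by simp⟩) hray
  refine ⟨M, hMi, fun θ v => ?_⟩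
  have e : (fun m : EuclideanSpace ℝ (Fin 2) =>
      (conj (d k) * w g ((bBase g).incl (Ψ ((BoundaryManifold.boundaryData 3 X).restrictDiffeomorph bX G₀.symm
        ((beltMap D k).boundaryTube.toHomeo (θ, m))))).1).im /
      (conj (d k) * w g ((bBase g).incl (Ψ ((BoundaryManifold.boundaryData 3 X).restrictDiffeomorph bX G₀.symm
        ((beltMap D k).boundaryTube.toHomeo (θ, m))))).1).re) =
      fun m : EuclideanSpace ℝ (Fin 2) =>
      (conj (d k) * w g (id ((BoundaryManifold.boundaryData 3 (Base g)).incl (seamDiffeo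
        (BoundaryManifold.boundaryData 3 X) (bBase g) Ψ' ((beltMap D k).boundaryTube.toHomeo (θ, m))))).1).im /
      (conj (d k) * w g (id ((BoundaryManifold.boundaryData 3 (Base g)).incl (seamDiffeo
        (BoundaryManifold.boundaryData 3 X) (bBase g) Ψ' ((beltMap D k).boundaryTube.toHomeo (θ, m))))).1).re := by
    funext m
    rw [id, incl_seamDiffeo_canonical]
  rw [e]
  exact hM θ v

/-! ## §3 Smoothness and the full differential of the belt slope at the belt circle -/

/-- **`W (u, m) = w (Ψ (B (u, m)))` is smooth on `ℝ × ball 0 1`.** [cite: Kosinski1993, VI §6] -/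
theorem contDiffOn_beltW :
    ContDiffOn ℝ ∞ (fun p : ℝ × EuclideanSpace ℝ (Fin 2) =>
      w g ((bBase g).incl (Ψ ((BoundaryManifold.boundaryData 3 X).restrictDiffeomorph bX G₀.symm
        ((beltMap D k).boundaryTube.toHomeo (circlePt p.1, p.2))))).1)
      (univ ×ˢ ball (0 : EuclideanSpace ℝ (Fin 2)) 1) := by
  have h1 := contMDiffOn_beltChart bX G₀ D k
  have h2 : ContMDiff (𝓡 3) 𝓘(ℝ, EuclideanSpace ℝ (Fin 4)) ∞ (fun y : bX.carrier => ((bBase g).incl (Ψ y)).1) :=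
    (RegularSublevel.contMDiff_incl (isRegularLevel_rho g)).comp
      ((bBase g).isSmoothEmbedding.contMDiff.comp Ψ.contMDiff)
  have h3 : ContMDiff 𝓘(ℝ, EuclideanSpace ℝ (Fin 4)) 𝓘(ℝ, ℂ) ∞ (w g) := (contDiff_w g).contMDiff
  have h := (h3.comp h2).comp_contMDiffOn h1
  exact contMDiffOn_iff_contDiffOn.1 h

/-- **A uniform belt on which `Re (c̄ W) > 0`** (`c := d k`): continuity of `W`, the ray condition on the belt
circle and `1`-periodicity in `u`. [folklore] -/
theorem exists_belt_re_pos
    (hbelt : ∀ (y : bX.carrier) (j : Fin n) (b : ↥(beltPiece 3 2)), G₀ (bX.incl y) = D.jB j b →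
      G₀ (bX.incl y) ∉ range D.jA →
      ∃ c : ℝ, 0 < c ∧ w g ((bBase g).incl (Ψ y)).1 = (c : ℂ) * d j)
    (hd : ‖d k‖ = 1) :
    ∃ ρ : ℝ, 0 < ρ ∧ ρ ≤ 1 ∧ ∀ (u : ℝ) (m : EuclideanSpace ℝ (Fin 2)), ‖m‖ < ρ →
      0 < (conj (d k) * w g ((bBase g).incl (Ψ ((BoundaryManifold.boundaryData 3 X).restrictDiffeomorph bX G₀.symm
        ((beltMap D k).boundaryTube.toHomeo (circlePt u, m))))).1).re := by
  set F : ℝ × EuclideanSpace ℝ (Fin 2) → ℝ := fun p =>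
    (conj (d k) * w g ((bBase g).incl (Ψ ((BoundaryManifold.boundaryData 3 X).restrictDiffeomorph bX G₀.symm
      ((beltMap D k).boundaryTube.toHomeo (circlePt p.1, p.2))))).1).re with hF
  have hFc : ContinuousOn F (univ ×ˢ ball (0 : EuclideanSpace ℝ (Fin 2)) 1) := by
    have h1 := (contDiffOn_beltW bX Ψ G₀ D k).continuousOn
    exact Complex.continuous_re.comp_continuousOn (continuousOn_const.mul h1)
  have hF0 : ∀ u, 0 < F (u, 0) := fun u => by
    obtain ⟨t, ht, hw⟩ := beltChart_zero_ray bX Ψ G₀ D d k hbelt (circlePt u)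
    show 0 < (conj (d k) * w g _).re
    rw [hw, (conj_mul_ray hd t).1]; exact ht
  have hF1 : ∀ u m, F (u + 1, m) = F (u, m) := fun u m => by
    simp only [hF, circlePt_add_one]
  -- the open set `{F > 0} ∩ (ℝ × ball)` contains `[0,1] × {0}`: generalized tube lemma
  have hO : IsOpen ((univ ×ˢ ball (0 : EuclideanSpace ℝ (Fin 2)) 1) ∩ F ⁻¹' Ioi (0 : ℝ)) :=
    hFc.isOpen_inter_preimage (t := Ioi (0 : ℝ)) (isOpen_univ.prod isOpen_ball) isOpen_Ioi
  have hsub : Icc (0 : ℝ) 1 ×ˢ ({(0 : EuclideanSpace ℝ (Fin 2))} : Set (EuclideanSpace ℝ (Fin 2))) ⊆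
      (univ ×ˢ ball (0 : EuclideanSpace ℝ (Fin 2)) 1) ∩ F ⁻¹' Ioi (0 : ℝ) := by
    rintro ⟨u, m⟩ ⟨-, hm⟩
    rw [mem_singleton_iff] at hm
    subst hm
    exact ⟨⟨mem_univ _, by simp⟩, hF0 u⟩
  obtain ⟨A, B, -, hBo, hA, hB, hAB⟩ := generalized_tube_lemma isCompact_Icc isCompact_singleton hO hsub
  obtain ⟨ρ₀, hρ₀, hball⟩ := Metric.isOpen_iff.1 hBo 0 (hB (mem_singleton _))
  refine ⟨min ρ₀ 1, lt_min hρ₀ one_pos, min_le_right _ _, fun u m hm => ?_⟩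
  have hmB : m ∈ B := hball (mem_ball_zero_iff.2 (lt_of_lt_of_le hm (min_le_left _ _)))
  have hper : Function.Periodic (fun u => F (u, m)) 1 := fun u => hF1 u m
  have e : F (Int.fract u, m) = F (u, m) := by
    have h := (hper.int_mul (-⌊u⌋)) u
    simp only [Int.cast_neg, mul_one] at h
    rw [Int.fract, sub_eq_add_neg]
    exact h
  have hmem := hAB (mk_mem_prod (hA ⟨Int.fract_nonneg u, (Int.fract_lt_one u).le⟩) hmB)
  have : 0 < F (Int.fract u, m) := hmem.2
  rwa [e] at this

/-- **The belt slope is smooth on the uniform belt** `ℝ × ball 0 ρ`. [folklore] -/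
theorem contDiffOn_beltSlope {ρ : ℝ} (hρ1 : ρ ≤ 1)
    (hre : ∀ (u : ℝ) (m : EuclideanSpace ℝ (Fin 2)), ‖m‖ < ρ →
      0 < (conj (d k) * w g ((bBase g).incl (Ψ ((BoundaryManifold.boundaryData 3 X).restrictDiffeomorph bX G₀.symm
        ((beltMap D k).boundaryTube.toHomeo (circlePt u, m))))).1).re) :
    ContDiffOn ℝ ∞ (fun p : ℝ × EuclideanSpace ℝ (Fin 2) =>
      (conj (d k) * w g ((bBase g).incl (Ψ ((BoundaryManifold.boundaryData 3 X).restrictDiffeomorph bX G₀.symm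
        ((beltMap D k).boundaryTube.toHomeo (circlePt p.1, p.2))))).1).im /
      (conj (d k) * w g ((bBase g).incl (Ψ ((BoundaryManifold.boundaryData 3 X).restrictDiffeomorph bX G₀.symm
        ((beltMap D k).boundaryTube.toHomeo (circlePt p.1, p.2))))).1).re)
      (univ ×ˢ ball (0 : EuclideanSpace ℝ (Fin 2)) ρ) := by
  have hsub : (univ : Set ℝ) ×ˢ ball (0 : EuclideanSpace ℝ (Fin 2)) ρ ⊆ univ ×ˢ ball (0 : EuclideanSpace ℝ (Fin 2)) 1 :=
    prod_mono (le_refl (univ : Set ℝ)) (ball_subset_ball hρ1)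
  have hW := (contDiffOn_beltW bX Ψ G₀ D k).mono hsub
  have hcW : ContDiffOn ℝ ∞ (fun p : ℝ × EuclideanSpace ℝ (Fin 2) => conj (d k) *
      w g ((bBase g).incl (Ψ ((BoundaryManifold.boundaryData 3 X).restrictDiffeomorph bX G₀.symm
        ((beltMap D k).boundaryTube.toHomeo (circlePt p.1, p.2))))).1) _ := contDiffOn_const.mul hW
  have hre' := Complex.reCLM.contDiff.comp_contDiffOn hcW
  have him' := Complex.imCLM.contDiff.comp_contDiffOn hcW
  refine him'.div hre' fun p hp => ?_
  exact (hre p.1 p.2 (mem_ball_zero_iff.1 hp.2)).ne'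

/-- A linear functional on `ℝ²` is determined by its values on the unit circle. [folklore] -/
theorem clm_eq_of_eq_on_sphere {L L' : EuclideanSpace ℝ (Fin 2) →L[ℝ] ℝ}
    (hLL : ∀ v : sphere (0 : EuclideanSpace ℝ (Fin 2)) 1, L v = L' v) : L = L' := by
  ext v
  by_cases hv : v = 0
  · rw [hv, map_zero, map_zero]
  · have hn : ‖v‖ ≠ 0 := norm_ne_zero_iff.2 hv
    have hvmem : (‖v‖⁻¹ : ℝ) • v ∈ sphere (0 : EuclideanSpace ℝ (Fin 2)) 1 := by
      rw [mem_sphere_zero_iff_norm, norm_smul, norm_inv, norm_norm, inv_mul_cancel₀ hn]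
    have h1 := hLL ⟨_, hvmem⟩
    simp only [map_smul, smul_eq_mul] at h1
    exact mul_left_cancel₀ (inv_ne_zero hn) h1

/-- **The belt slope package** (brick H4-4).  THE BELT SLOPE IS A SUBMERSION ALONG THE BELT CIRCLE, WITH THE LINEAR
DEEP-BELT MODEL: in the telescope of `node_N1_move`, under the seam and belt clauses through `G₀` and with the core of
handle `k` in the page of the unit direction `d k`, there are a width `ρ ∈ (0, 1]` and an injective `M : ℝ² →L ℝ²` such
that the belt slope `Sl (u, m) := S_{d k} (w (Ψ (∂(G₀⁻¹) (β♭ (e^{2πiu}, m)))))` has positive denominator and is smooth on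
`ℝ × ball 0 ρ`, vanishes on the belt circle, and has at every `(u, 0)` the differential `(δu, δm) ↦ ⟪M (e^{2πiu}), δm⟫`.
[cite: EtnyreFuller2006, Thm. 1 (proof, p. 8)] -/
theorem beltSlope_package : ∀ (g n : ℕ) (h : Fin n → Literature.Topology.FourManifolds.HandleAttachingMap 3 2 (Literature.Topology.FourManifolds.LefschetzBase.Base g)) (X₀ : Type) [TopologicalSpace X₀] [ChartedSpace (EuclideanHalfSpace 4) X₀] (bX : Literature.Topology.FourManifolds.BoundaryData (𝓡∂ 4) X₀ (𝓡 3)) (Ψ : bX.carrier ≃ₘ⟮𝓡 3, 𝓡 3⟯ (Literature.Topology.FourManifolds.LefschetzBase.bBase g).carrier) (X : Type) [TopologicalSpace X] [ChartedSpace (EuclideanHalfSpace 4) X] [IsManifold (𝓡∂ 4) ∞ X] (G₀ : X₀ ≃ₘ⟮𝓡∂ 4, 𝓡∂ 4⟯ X) (D : Literature.Topology.FourManifolds.HandleAttachingMap.MultiAttachmentData h (𝓡∂ 4) X) (d : Fin n → ℂ) (k : Fin n), ‖d k‖ = 1 → (∀ θ, (h k).attachingCircle θ ∈ Literature.Topology.FourManifolds.LefschetzBase.page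 g (d k)) → (∀ (y : bX.carrier) (a : ↥(Literature.Topology.FourManifolds.HandleAttachingMap.coresComplement h)), G₀ (bX.incl y) = D.jA a → ∃ c : ℝ, 0 < c ∧ Literature.Topology.FourManifolds.LefschetzBase.w g ((Literature.Topology.FourManifolds.LefschetzBase.bBase g).incl (Ψ y)).1 = (c : ℂ) * Literature.Topology.FourManifolds.LefschetzBase.w g (a : Literature.Topology.FourManifolds.LefschetzBase.Base g).1) → (∀ (y : bX.carrier) (j : Fin n) (b : ↥(Literature.Topology.FourManifolds.beltPiece 3 2)), G₀ (bX.incl y) = D.jB j b → G₀ (bX.incl y) ∉ Set.range D.jA → ∃ c : ℝ, 0 < c ∧ Literature.Topology.FourManifolds.LefschetzBase.w g ((Literature.Topology.FourManifolds.LefschetzBase.bBase g).incl (Ψ y)).1 = (c : ℂ) * d j) → ∃ (ρ : ℝ) (M : EuclideanSpace ℝ (Fin 2) →L[ℝ] EuclideanSpace ℝ (Fin 2)), 0 < ρ ∧ ρ ≤ 1 ∧ Function.Injective M ∧ (∀ (u : ℝ) (m : EuclideanSpace ℝ (Fin 2)), ‖m‖ < ρ → 0 < ((starRingEnd ℂ)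 (d k) * Literature.Topology.FourManifolds.LefschetzBase.w g ((Literature.Topology.FourManifolds.LefschetzBase.bBase g).incl (Ψ ((Literature.Topology.FourManifolds.BoundaryManifold.boundaryData 3 X).restrictDiffeomorph bX G₀.symm ((Summit.SmoothPoincare4.SmoothPoincare4.Theorems.AcyclicBisectionExists.ModpBraidOrbits.beltMap D k).boundaryTube.toHomeo (Literature.Topology.FourManifolds.circlePt u, m))))).1).re) ∧ ContDiffOn ℝ ∞ (fun p : ℝ × EuclideanSpace ℝ (Fin 2) => ((starRingEnd ℂ) (d k) * Literature.Topology.FourManifolds.LefschetzBase.w g ((Literature.Topology.FourManifolds.LefschetzBase.bBase g).incl (Ψ ((Literature.Topology.FourManifolds.BoundaryManifold.boundaryData 3 X).restrictDiffeomorph bX G₀.symm ((Summit.SmoothPoincare4.SmoothPoincare4.Theorems.AcyclicBisectionExists.ModpBraidOrbits.beltMap D k).boundaryTube.toHomeo (Literature.Topology.FourManifolds.circlePt p.1, p.2))))).1).im / ((starRingEnd ℂ) (d k) * Literature.Topology.FourManifolds.LefschetzBase.w g ((Literature.Topology.FourManifolds.LefschetzBase.bBase g).incl (Ψ ((Literature.Topology.FourManifolds.BoundaryManifold.boundaryData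 3 X).restrictDiffeomorph bX G₀.symm ((Summit.SmoothPoincare4.SmoothPoincare4.Theorems.AcyclicBisectionExists.ModpBraidOrbits.beltMap D k).boundaryTube.toHomeo (Literature.Topology.FourManifolds.circlePt p.1, p.2))))).1).re) (Set.univ ×ˢ Metric.ball (0 : EuclideanSpace ℝ (Fin 2)) ρ) ∧ (∀ u : ℝ, ((starRingEnd ℂ) (d k) * Literature.Topology.FourManifolds.LefschetzBase.w g ((Literature.Topology.FourManifolds.LefschetzBase.bBase g).incl (Ψ ((Literature.Topology.FourManifolds.BoundaryManifold.boundaryData 3 X).restrictDiffeomorph bX G₀.symm ((Summit.SmoothPoincare4.SmoothPoincare4.Theorems.AcyclicBisectionExists.ModpBraidOrbits.beltMap D k).boundaryTube.toHomeo (Literature.Topology.FourManifolds.circlePt u, (0 : EuclideanSpace ℝ (Fin 2))))))).1).im = 0) ∧ ∀ u : ℝ, HasFDerivAt (fun p : ℝ × EuclideanSpace ℝ (Fin 2) => ((starRingEnd ℂ) (d k) * Literature.Topology.FourManifolds.LefschetzBase.w g ((Literature.Topology.FourManifolds.LefschetzBase.bBase g).incl (Ψ ((Literature.Topology.FourManifolds.BoundaryManifold.boundaryData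 3 X).restrictDiffeomorph bX G₀.symm ((Summit.SmoothPoincare4.SmoothPoincare4.Theorems.AcyclicBisectionExists.ModpBraidOrbits.beltMap D k).boundaryTube.toHomeo (Literature.Topology.FourManifolds.circlePt p.1, p.2))))).1).im / ((starRingEnd ℂ) (d k) * Literature.Topology.FourManifolds.LefschetzBase.w g ((Literature.Topology.FourManifolds.LefschetzBase.bBase g).incl (Ψ ((Literature.Topology.FourManifolds.BoundaryManifold.boundaryData 3 X).restrictDiffeomorph bX G₀.symm ((Summit.SmoothPoincare4.SmoothPoincare4.Theorems.AcyclicBisectionExists.ModpBraidOrbits.beltMap D k).boundaryTube.toHomeo (Literature.Topology.FourManifolds.circlePt p.1, p.2))))).1).re) ((innerSL ℝ (M (Literature.Topology.FourManifolds.circlePt u : EuclideanSpace ℝ (Fin 2)))).comp (ContinuousLinearMap.snd ℝ ℝ (EuclideanSpace ℝ (Fin 2)))) (u, 0) := by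
  intro g n h X₀ _ _ bX Ψ X _ _ _ G₀ D d k hd hcore hseam hbelt
  obtain ⟨ρ, hρ, hρ1, hre⟩ := exists_belt_re_pos bX Ψ G₀ D d k hbelt hd
  obtain ⟨M, hMi, hM⟩ := exists_beltMatrix_G₀ bX Ψ G₀ D d k hd hcore hseam hbelt
  have hSl := contDiffOn_beltSlope bX Ψ G₀ D d k hρ1 hre
  -- the slope as an opaque function `Sl`
  obtain ⟨Sl, hSl_def⟩ : ∃ Sl : ℝ × EuclideanSpace ℝ (Fin 2) → ℝ, ∀ p, Sl p =
      (conj (d k) * w g ((bBase g).incl (Ψ ((BoundaryManifold.boundaryData 3 X).restrictDiffeomorph bX G₀.symm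
        ((beltMap D k).boundaryTube.toHomeo (circlePt p.1, p.2))))).1).im /
      (conj (d k) * w g ((bBase g).incl (Ψ ((BoundaryManifold.boundaryData 3 X).restrictDiffeomorph bX G₀.symm
        ((beltMap D k).boundaryTube.toHomeo (circlePt p.1, p.2))))).1).re := ⟨_, fun _ => rfl⟩
  have hSl_eq : (fun p : ℝ × EuclideanSpace ℝ (Fin 2) =>
      (conj (d k) * w g ((bBase g).incl (Ψ ((BoundaryManifold.boundaryData 3 X).restrictDiffeomorph bX G₀.symm
        ((beltMap D k).boundaryTube.toHomeo (circlePt p.1, p.2))))).1).im /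
      (conj (d k) * w g ((bBase g).incl (Ψ ((BoundaryManifold.boundaryData 3 X).restrictDiffeomorph bX G₀.symm
        ((beltMap D k).boundaryTube.toHomeo (circlePt p.1, p.2))))).1).re) = Sl :=
    funext fun p => (hSl_def p).symm
  have hSl' : ContDiffOn ℝ ∞ Sl ((univ : Set ℝ) ×ˢ ball (0 : EuclideanSpace ℝ (Fin 2)) ρ) := by
    rw [← hSl_eq]; exact hSl
  have him0 : ∀ u : ℝ, (conj (d k) * w g ((bBase g).incl (Ψ ((BoundaryManifold.boundaryData 3 X).restrictDiffeomorph
      bX G₀.symm ((beltMap D k).boundaryTube.toHomeo (circlePt u, (0 : EuclideanSpace ℝ (Fin 2))))))).1).im = 0 := by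
    intro u
    obtain ⟨t, -, hw⟩ := beltChart_zero_ray bX Ψ G₀ D d k hbelt (circlePt u)
    rw [hw, (conj_mul_ray hd t).2]
  have hSl0 : ∀ u : ℝ, Sl (u, 0) = 0 := fun u => by
    rw [hSl_def]
    show _ / _ = 0
    rw [him0 u, zero_div]
  refine ⟨ρ, M, hρ, hρ1, hMi, hre, hSl, him0, fun u => ?_⟩
  rw [hSl_eq]
  -- differentiability at `(u, 0)` from smoothness on the open belt
  have hopen : IsOpen ((univ : Set ℝ) ×ˢ ball (0 : EuclideanSpace ℝ (Fin 2)) ρ) := isOpen_univ.prod isOpen_ball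
  have hmem : ((u, (0 : EuclideanSpace ℝ (Fin 2))) : ℝ × EuclideanSpace ℝ (Fin 2)) ∈
      (univ : Set ℝ) ×ˢ ball (0 : EuclideanSpace ℝ (Fin 2)) ρ := ⟨mem_univ _, by simp [hρ]⟩
  have hdiff : DifferentiableAt ℝ Sl (u, 0) :=
    (hSl'.differentiableOn (by simp)).differentiableAt (hopen.mem_nhds hmem)
  set L := fderiv ℝ Sl (u, 0) with hL
  have hHas : HasFDerivAt Sl L (u, 0) := hdiff.hasFDerivAt
  -- the `u`-partial vanishes: `Sl (·, 0) ≡ 0`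
  have hLu : ∀ a : ℝ, L (a, 0) = 0 := by
    intro a
    have hc : HasFDerivAt (fun u' : ℝ => ((u', (0 : EuclideanSpace ℝ (Fin 2))) : ℝ × EuclideanSpace ℝ (Fin 2)))
        (ContinuousLinearMap.inl ℝ ℝ (EuclideanSpace ℝ (Fin 2))) u := hasFDerivAt_prodMk_left u 0
    have h1 := hHas.comp u hc
    have e : (Sl ∘ fun u' : ℝ => ((u', (0 : EuclideanSpace ℝ (Fin 2))) : ℝ × EuclideanSpace ℝ (Fin 2))) =
        fun _ => (0 : ℝ) := funext fun u' => hSl0 u'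
    rw [e] at h1
    have h3 := h1.unique (hasFDerivAt_const (0 : ℝ) u)
    have := congrArg (fun T : ℝ →L[ℝ] ℝ => T a) h3
    simpa using this
  -- the `m`-partial is `⟪M θ, ·⟫`
  have hLm : ∀ b : EuclideanSpace ℝ (Fin 2), L (0, b) = inner ℝ (M (circlePt u : EuclideanSpace ℝ (Fin 2))) b := by
    have hc : HasFDerivAt (fun m : EuclideanSpace ℝ (Fin 2) => ((u, m) : ℝ × EuclideanSpace ℝ (Fin 2)))
        (ContinuousLinearMap.inr ℝ ℝ (EuclideanSpace ℝ (Fin 2))) 0 := hasFDerivAt_prodMk_right u 0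
    have h1 := hHas.comp (0 : EuclideanSpace ℝ (Fin 2)) hc
    have e2 : (Sl ∘ fun m : EuclideanSpace ℝ (Fin 2) => ((u, m) : ℝ × EuclideanSpace ℝ (Fin 2))) =
        fun m : EuclideanSpace ℝ (Fin 2) =>
          (conj (d k) * w g ((bBase g).incl (Ψ ((BoundaryManifold.boundaryData 3 X).restrictDiffeomorph bX G₀.symm
            ((beltMap D k).boundaryTube.toHomeo (circlePt u, m))))).1).im /
          (conj (d k) * w g ((bBase g).incl (Ψ ((BoundaryManifold.boundaryData 3 X).restrictDiffeomorph bX G₀.symm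
            ((beltMap D k).boundaryTube.toHomeo (circlePt u, m))))).1).re := by
      funext m
      simp only [Function.comp_apply, hSl_def]
    rw [e2] at h1
    have h2 := h1.fderiv
    have h3 : L.comp (ContinuousLinearMap.inr ℝ ℝ (EuclideanSpace ℝ (Fin 2))) =
        innerSL ℝ (M (circlePt u : EuclideanSpace ℝ (Fin 2))) := by
      apply clm_eq_of_eq_on_sphere
      intro v
      rw [← h2, innerSL_apply_apply]
      exact hM (circlePt u) v
    intro b
    have := congrArg (fun T : EuclideanSpace ℝ (Fin 2) →L[ℝ] ℝ => T b) h3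
    simpa using this
  -- assemble
  have hLeq : L = (innerSL ℝ (M (circlePt u : EuclideanSpace ℝ (Fin 2)))).comp
      (ContinuousLinearMap.snd ℝ ℝ (EuclideanSpace ℝ (Fin 2))) := by
    apply ContinuousLinearMap.ext
    rintro ⟨a, b⟩
    have e : ((a, b) : ℝ × EuclideanSpace ℝ (Fin 2)) = (a, 0) + (0, b) := by simp
    rw [e, map_add, hLu, hLm]
    simp
  rw [← hLeq]
  exact hHas

/-- **Sub-goal `helper_beltSlope_hasFDerivAt` of stub `stub_M2geo`** (N1 ▸ `node_N1_move` ▸ (d) N1-mono, brick H4-4;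
wave 7, lead c5; the registered packaging of `beltSlope_package`).  In the telescope of `node_N1_move`, under the
seam and belt clauses through `G₀` and with the core of handle `k` in the page of the unit direction `d k`, there is
an injective `M : ℝ² →L ℝ²` such that the belt slope `(u, m) ↦ S_{d k} (w (Ψ (∂(G₀⁻¹) (β♭ (e^{2πiu}, m)))))` has at
every belt-circle point `(u, 0)` the differential `(δu, δm) ↦ ⟪M (e^{2πiu}), δm⟫` (a submersion along the belt circle,
with vanishing `u`-derivative). [cite: EtnyreFuller2006, Thm. 1 (proof, p. 8)] -/
theorem helper_beltSlope_hasFDerivAt : ∀ (g n : ℕ) (h : Fin n → Literature.Topology.FourManifolds.HandleAttachingMap 3 2 (Literature.Topology.FourManifolds.LefschetzBase.Base g)) (X₀ : Type) [TopologicalSpace X₀] [ChartedSpace (EuclideanHalfSpace 4) X₀] (bX : Literature.Topology.FourManifolds.BoundaryData (𝓡∂ 4) X₀ (𝓡 3)) (Ψ : bX.carrier ≃ₘ⟮𝓡 3, 𝓡 3⟯ (Literature.Topology.FourManifolds.LefschetzBase.bBase g).carrier) (X : Type) [TopologicalSpace X] [ChartedSpace (EuclideanHalfSpace 4) X] [IsManifold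 (𝓡∂ 4) ∞ X] (G₀ : X₀ ≃ₘ⟮𝓡∂ 4, 𝓡∂ 4⟯ X) (D : Literature.Topology.FourManifolds.HandleAttachingMap.MultiAttachmentData h (𝓡∂ 4) X) (d : Fin n → ℂ) (k : Fin n), ‖d k‖ = 1 → (∀ θ, (h k).attachingCircle θ ∈ Literature.Topology.FourManifolds.LefschetzBase.page g (d k)) → (∀ (y : bX.carrier) (a : ↥(Literature.Topology.FourManifolds.HandleAttachingMap.coresComplement h)), G₀ (bX.incl y) = D.jA a → ∃ c : ℝ, 0 < c ∧ Literature.Topology.FourManifolds.LefschetzBase.w g ((Literature.Topology.FourManifolds.LefschetzBase.bBase g).incl (Ψ y)).1 = (c : ℂ) * Literature.Topology.FourManifolds.LefschetzBase.w g (a : Literature.Topology.FourManifolds.LefschetzBase.Base g).1) → (∀ (y : bX.carrier) (j : Fin n) (b : ↥(Literature.Topology.FourManifolds.beltPiece 3 2)), G₀ (bX.incl y) = D.jB j b → G₀ (bX.incl y) ∉ Set.range D.jA → ∃ c : ℝ, 0 < c ∧ Literature.Topology.FourManifolds.LefschetzBase.w g ((Literature.Topology.FourManifolds.LefschetzBase.bBase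 g).incl (Ψ y)).1 = (c : ℂ) * d j) → ∃ M : EuclideanSpace ℝ (Fin 2) →L[ℝ] EuclideanSpace ℝ (Fin 2), Function.Injective M ∧ ∀ u : ℝ, HasFDerivAt (fun p : ℝ × EuclideanSpace ℝ (Fin 2) => ((starRingEnd ℂ) (d k) * Literature.Topology.FourManifolds.LefschetzBase.w g ((Literature.Topology.FourManifolds.LefschetzBase.bBase g).incl (Ψ ((Literature.Topology.FourManifolds.BoundaryManifold.boundaryData 3 X).restrictDiffeomorph bX G₀.symm ((Summit.SmoothPoincare4.SmoothPoincare4.Theorems.AcyclicBisectionExists.ModpBraidOrbits.beltMap D k).boundaryTube.toHomeo (Literature.Topology.FourManifolds.circlePt p.1, p.2))))).1).im / ((starRingEnd ℂ) (d k) * Literature.Topology.FourManifolds.LefschetzBase.w g ((Literature.Topology.FourManifolds.LefschetzBase.bBase g).incl (Ψ ((Literature.Topology.FourManifolds.BoundaryManifold.boundaryData 3 X).restrictDiffeomorph bX G₀.symm ((Summit.SmoothPoincare4.SmoothPoincare4.Theorems.AcyclicBisectionExists.ModpBraidOrbits.beltMap D k).boundaryTube.toHomeo (Literature.Topology.FourManifolds.circlePt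 p.1, p.2))))).1).re) ((innerSL ℝ (M (Literature.Topology.FourManifolds.circlePt u : EuclideanSpace ℝ (Fin 2)))).comp (ContinuousLinearMap.snd ℝ ℝ (EuclideanSpace ℝ (Fin 2)))) (u, 0) := by
  intro g n h X₀ _ _ bX Ψ X _ _ _ G₀ D d k hd hcore hseam hbelt
  obtain ⟨ρ, M, -, -, hMi, -, -, -, hM⟩ := beltSlope_package g n h X₀ bX Ψ X G₀ D d k hd hcore hseam hbelt
  exact ⟨M, hMi, hM⟩

end Summit.SmoothPoincare4.SmoothPoincare4.Theorems.AcyclicBisectionExists.ModpBraidOrbits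

end
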